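import Literature.Probability.RandomPlanarGeometry.HexSAWBrickWallStripFugacityWidthOnePartialFractionRing
import Literature.Analysis.Asymptotics.TwoWallCoefficientRecurrences
import HarnessLib

/-!
# The two-wall strip partition function at arbitrary (complex) fugacity: coefficient decomposition `d·C_{1,N} = u_N + e_N` and the
# recurrences of the two parts

Topic `Literature/Probability/RandomPlanarGeometry` (continues `…WidthOnePartialFractionRing.lean` — the partial fraction `d·P = E·qQ² + U·Q² + V·q` and the
decomposition of `Σ C_{1,N}(w,v)X^N` in `R⟦X⟧` for every commutative ring `R` — and `Literature/Analysis/Asymptotics/TwoWallCoefficientRecurrences.lean` —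
the order-6/8 coefficient recurrences and the parity two-term asymptotics).  THIS FILE extracts coefficients: with `iq`, `iQ` the inverses of
`q = (1 − wX²)(1 − vX²) − wvX⁶` and `Q² = (1 − wvX⁴)²` in `R⟦X⟧`,

* §1 `coeff_poly2C/6C/8C` — the tails of the coefficient sequences of polynomials of degree `≤ 1, 5, 7` vanish (generic-ring copies of the tree's real
  `coeff_poly2/6/8`, tails only).
* §2 ★ `stripZ₂C_coeff_decomposition` — for every commutative ring `R`, all `w, v ∈ R` and every `N`:
  `d·C_{1,N+2}(w,v) = [X^{N+2}](U·iq) + [X^{N+2}](V·iQ)`, and the two coefficient sequences obey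
  `u_{N+6} = (w+v)u_{N+4} − wv·u_{N+2} + wv·u_N`, `e_{N+8} = 2wv·e_{N+4} − (wv)²e_N` (`stripZ₂C_uPart_rec`, `stripZ₂C_ePart_rec`).
* §3 ★ `norm_ePart_le` — over `ℂ`, the `e`-part along residues mod 4: `‖e_{4k+j}‖ ≤ (k+1)‖wv‖^k(‖e_j‖ + ‖e_{j+4}‖/‖wv‖)` (`wv ≠ 0`; the double-root companion
  of `ComplexLinearRecurrenceDominantRoot`).
Together with `exists_tendsto_parity_of_rec_six` (the `u`-part, given a dominant root `s` of `s(s−w)(s−v) = wv` and a cofactor root bound `R < ‖s‖`) this is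
the complex two-term asymptotics of `C_{1,N}(w,v)` up to the choice of `s(w,v)` and `R` (DOOR-ap5-g27 item 1, bricks B6/B7).

## Sources
R. P. Stanley, *Enumerative Combinatorics* 1 (2nd ed.) §4.1 Theorem 4.1.1; N. R. Beaton et al., CMP 326 (2014), arXiv:1109.0358v5 §3.2 (p. 12).  Lane statements;
nothing is quoted AS PRINTED.
-/

noncomputable section

open Finset PowerSeries Literature.Analysis.Asymptotics

namespace Literature.Probability.RandomPlanarGeometry.SAW.HexBW

namespace WidthOneYZ

/-! ## §1 Coefficient tails of low-degree polynomials (generic ring) -/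

/-- `[X^{N+2}](a₀ + a₁X) = 0`. [cite: Stanley2012EC1, §4.1 (lane plumbing)] -/
theorem coeff_poly2C {R : Type*} [CommRing R] (a0 a1 : R) (N : ℕ) : coeff (N + 2) (C a0 + C a1 * X) = 0 := by
  simp only [map_add, PowerSeries.coeff_C_mul, PowerSeries.coeff_C, coeff_X, Nat.reduceEqDiff, if_false, mul_zero, add_zero]

/-- `[X^{N+6}](Σ_{j≤5} a_j X^j) = 0`. [cite: Stanley2012EC1, §4.1 (lane plumbing)] -/
theorem coeff_poly6C {R : Type*} [CommRing R] (a0 a1 a2 a3 a4 a5 : R) (N : ℕ) :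
    coeff (N + 6) (C a0 + C a1 * X + C a2 * X ^ 2 + C a3 * X ^ 3 + C a4 * X ^ 4 + C a5 * X ^ 5) = 0 := by
  simp only [map_add, PowerSeries.coeff_C_mul, PowerSeries.coeff_C, coeff_X, PowerSeries.coeff_X_pow,
    Nat.reduceEqDiff, if_false, mul_zero, add_zero]

/-- `[X^{N+8}](Σ_{j≤7} a_j X^j) = 0`. [cite: Stanley2012EC1, §4.1 (lane plumbing)] -/
theorem coeff_poly8C {R : Type*} [CommRing R] (a0 a1 a2 a3 a4 a5 a6 a7 : R) (N : ℕ) :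
    coeff (N + 8) (C a0 + C a1 * X + C a2 * X ^ 2 + C a3 * X ^ 3 + C a4 * X ^ 4 + C a5 * X ^ 5 + C a6 * X ^ 6 + C a7 * X ^ 7) = 0 := by
  simp only [map_add, PowerSeries.coeff_C_mul, PowerSeries.coeff_C, coeff_X, PowerSeries.coeff_X_pow,
    Nat.reduceEqDiff, if_false, mul_zero, add_zero]

/-! ## §2 ★ The coefficient decomposition over any commutative ring -/

section Decomposition

variable {R : Type*} [CommRing R] (w v : R)

/-- The `U`-numerator of the partial fraction as a power series. [cite: Stanley2012EC1, §4.1 Theorem 4.1.1 (iii) (lane notation)] -/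
def twoWallUC : R⟦X⟧ :=
  C (pfU₀C w v) + C (pfU₁C w v) * X + C (pfU₂C w v) * X ^ 2 + C (pfU₃C w v) * X ^ 3 + C (pfU₄C w v) * X ^ 4 + C (pfU₅C w v) * X ^ 5

/-- The `V`-numerator of the partial fraction as a power series. [cite: Stanley2012EC1, §4.1 Theorem 4.1.1 (iii) (lane notation)] -/
def twoWallVC : R⟦X⟧ :=
  C (pfV₀C w v) + C (pfV₁C w v) * X + C (pfV₂C w v) * X ^ 2 + C (pfV₃C w v) * X ^ 3 + C (pfV₄C w v) * X ^ 4 + C (pfV₅C w v) * X ^ 5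
    + C (pfV₆C w v) * X ^ 6 + C (pfV₇C w v) * X ^ 7

variable {w v}

/-- ★ **THE COEFFICIENT DECOMPOSITION `d·C_{1,N+2} = u_{N+2} + e_{N+2}` AT ARBITRARY FUGACITY.**  For every commutative ring `R`, all `w, v ∈ R`, all
power series `iq, iQ` with `q·iq = 1`, `Q²·iQ = 1` (they exist: both have constant coefficient `1`), and every `N`:
`d·C_{1,N+2}(w,v) = [X^{N+2}](U·iq) + [X^{N+2}](V·iQ)`, `d = ((w−v)² + 2w + 2v + 1)²`.
[cite: Stanley2012EC1, §4.1 Theorem 4.1.1 (iii) (partial fractions ⇒ exponential-polynomial coefficients; lane statement at generic fugacity)] -/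
theorem stripZ₂C_coeff_decomposition {iq iQ : R⟦X⟧}
    (hqinv : ((1 - C w * X ^ 2) * (1 - C v * X ^ 2) - C w * C v * X ^ 6) * iq = 1)
    (hQinv : (1 - C w * C v * X ^ 4) ^ 2 * iQ = 1) (N : ℕ) :
    ((w - v) ^ 2 + 2 * w + 2 * v + 1) ^ 2 * stripZ₂C 1 (N + 2) w v
      = coeff (N + 2) (twoWallUC w v * iq) + coeff (N + 2) (twoWallVC w v * iQ) := by
  set Aser : R⟦X⟧ := PowerSeries.mk (fun N => stripZ₂C 1 N w v) with hAser
  set qX : R⟦X⟧ := (1 - C w * X ^ 2) * (1 - C v * X ^ 2) - C w * C v * X ^ 6 with hqX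
  set Q2 : R⟦X⟧ := (1 - C w * C v * X ^ 4) ^ 2 with hQ2
  set E : R⟦X⟧ := C (pfE₀C w v) + C (pfE₁C w v) * X with hE
  have hdecomp := stripZ₂C_one_series_decomposition w v
  have hD : twoWallDC w v = qX * Q2 := rfl
  rw [hD] at hdecomp
  have hPF : C (((w - v) ^ 2 + 2 * w + 2 * v + 1) ^ 2) * (Aser * (qX * Q2)) = E * (qX * Q2) + twoWallUC w v * Q2 + twoWallVC w v * qX := by
    rw [hdecomp]; simp only [hE, hqX, hQ2, twoWallUC, twoWallVC]
  have hdec : C (((w - v) ^ 2 + 2 * w + 2 * v + 1) ^ 2) * Aser = E + twoWallUC w v * iq + twoWallVC w v * iQ := by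
    linear_combination (-(C (((w - v) ^ 2 + 2 * w + 2 * v + 1) ^ 2)) * Aser * Q2 * iQ + E * Q2 * iQ + twoWallVC w v * iQ) * hqinv
      + (-(C (((w - v) ^ 2 + 2 * w + 2 * v + 1) ^ 2)) * Aser + E + twoWallUC w v * iq) * hQinv + (iq * iQ) * hPF
  have hEN : coeff (N + 2) E = 0 := coeff_poly2C _ _ N
  have := congrArg (coeff (N + 2)) hdec
  simp only [hAser, map_add, PowerSeries.coeff_C_mul, coeff_mk, hEN, zero_add] at this
  exact this

/-- ★ **The `u`-part obeys the order-6 recurrence**: `u_{N+6} = (w+v)u_{N+4} − wv·u_{N+2} + wv·u_N`, `u_N = [X^N](U·iq)`.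
[cite: Stanley2012EC1, §4.1 Theorem 4.1.1 ((i) ⟺ (ii))] -/
theorem stripZ₂C_uPart_rec {iq : R⟦X⟧} (hqinv : ((1 - C w * X ^ 2) * (1 - C v * X ^ 2) - C w * C v * X ^ 6) * iq = 1) (N : ℕ) :
    coeff (N + 6) (twoWallUC w v * iq) = (w + v) * coeff (N + 4) (twoWallUC w v * iq) - w * v * coeff (N + 2) (twoWallUC w v * iq)
      + w * v * coeff N (twoWallUC w v * iq) := by
  have hUiq : twoWallUC w v * iq * ((1 - C w * X ^ 2) * (1 - C v * X ^ 2) - C w * C v * X ^ 6) = twoWallUC w v := by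
    rw [mul_assoc, mul_comm iq, hqinv, mul_one]
  have h := coeff_rec_six_of_mul_sextic hUiq N
  have hU : coeff (N + 6) (twoWallUC w v) = 0 := coeff_poly6C _ _ _ _ _ _ N
  rw [hU, add_zero] at h
  exact h

/-- ★ **The `e`-part obeys the order-8 recurrence**: `e_{N+8} = 2wv·e_{N+4} − (wv)²·e_N`, `e_N = [X^N](V·iQ)`.
[cite: Stanley2012EC1, §4.1 Theorem 4.1.1 ((i) ⟺ (ii))] -/
theorem stripZ₂C_ePart_rec {iQ : R⟦X⟧} (hQinv : (1 - C w * C v * X ^ 4) ^ 2 * iQ = 1) (N : ℕ) :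
    coeff (N + 8) (twoWallVC w v * iQ) = 2 * (w * v) * coeff (N + 4) (twoWallVC w v * iQ) - (w * v) ^ 2 * coeff N (twoWallVC w v * iQ) := by
  have hViQ : twoWallVC w v * iQ * (1 - C w * C v * X ^ 4) ^ 2 = twoWallVC w v := by
    rw [mul_assoc, mul_comm iQ, hQinv, mul_one]
  have h := coeff_rec_eight_of_mul_sq hViQ N
  have hV : coeff (N + 8) (twoWallVC w v) = 0 := coeff_poly8C _ _ _ _ _ _ _ _ N
  rw [hV, add_zero] at h
  exact h

/-- The inverses exist: `q` and `Q²` have constant coefficient `1`. [cite: Stanley2012EC1, §4.1 (lane plumbing)] -/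
theorem exists_twoWall_inverses (w v : R) :
    ∃ iq iQ : R⟦X⟧, ((1 - C w * X ^ 2) * (1 - C v * X ^ 2) - C w * C v * X ^ 6) * iq = 1 ∧ (1 - C w * C v * X ^ 4) ^ 2 * iQ = 1 := by
  refine ⟨PowerSeries.invOfUnit _ 1, PowerSeries.invOfUnit _ 1, PowerSeries.mul_invOfUnit _ 1 ?_, PowerSeries.mul_invOfUnit _ 1 ?_⟩
  · simp
  · simp

end Decomposition

/-! ## §3 ★ The `e`-part is geometrically small: residues mod 4 and the double root `wv` -/

/-- ★ **Bound for the `e`-part over `ℂ`**: if `e_{N+8} = 2ω e_{N+4} − ω² e_N` (`ω ∈ ℂ`, `ω ≠ 0`) then along every residue class mod 4,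
`‖e_{4k+j}‖ ≤ (k+1)·‖ω‖^k·(‖e_j‖ + ‖e_{j+4}‖/‖ω‖)` (the mod-4 subsequence obeys `f_{k+2} = 2ω f_{k+1} − ω² f_k`;
`norm_le_of_rec_two_double_root_complex`). [cite: Stanley2012EC1, §4.1 Theorem 4.1.1 (iii) (lane statement, complex data)] -/
theorem norm_ePart_le {ω : ℂ} (hω : ω ≠ 0) {e : ℕ → ℂ} (he : ∀ N, e (N + 8) = 2 * ω * e (N + 4) - ω ^ 2 * e N) (j k : ℕ) :
    ‖e (4 * k + j)‖ ≤ ((k : ℝ) + 1) * ‖ω‖ ^ k * (‖e j‖ + ‖e (j + 4)‖ / ‖ω‖) := by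
  have h := norm_le_of_rec_two_double_root_complex (f := fun k => e (4 * k + j)) hω (fun k => by
    show e (4 * (k + 2) + j) = 2 * ω * e (4 * (k + 1) + j) - ω ^ 2 * e (4 * k + j)
    rw [show 4 * (k + 2) + j = 4 * k + j + 8 by ring, show 4 * (k + 1) + j = 4 * k + j + 4 by ring, he]) k
  simp only [mul_zero, zero_add, mul_one] at h
  rw [show 4 + j = j + 4 by ring] at h
  exact h

end WidthOneYZ

end Literature.Probability.RandomPlanarGeometry.SAW.HexBW

end
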